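import Literature.Analysis.ODE.CompactSupportFlow
import Literature.Topology.FourManifolds.ExpHeightCritical
import Mathlib.Analysis.SpecialFunctions.SmoothTransition
import Mathlib.Analysis.InnerProductSpace.Dual
import Mathlib.Analysis.InnerProductSpace.Calculus
import Mathlib.Analysis.Calculus.LocalExtr.Basic
import HarnessLib

/-!
# A regular family of compact domains `{F_τ ≤ 0}` is carried by an ambient diffeomorphism

Topic `Literature/Topology/FourManifolds`; foundational brick of the exp-height line of the fact
seat `provefact-Literature.Topology.FourManifolds.SphereEmbedding.schoenflies_exists_ball`
(Alexander's theorem, Schultens (2014), Thm. 3.2.5), after `ExpHeightCritical.lean`,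
`ExpHeightBall.lean`, `HeightTwoCriticalBall.lean`.  **Everything in this file is proved; no
definitions, no named facts.**

The cut-and-paste steps of Alexander's argument (Schultens' Lemma 3.2.3, "`(S₁ - D₁) ∪ D₂` is
isotopic to `S₁`"; the absorption of a ball bounded by a level disc and a disc of the sphere) will
be realised on the *regions* as **regular one-parameter families of defining functions**: a
smooth `F : ℝ × E → ℝ` such that every `F_τ = F(τ, ·)`, `τ ∈ [0, 1]`, has `0` as a regular value
and compact band `{|F_τ| ≤ ε₀}`.  This file proves the isotopy lemma that makes such families
useful:

* `RegularFamily.exists_diffeomorph_sign_eq` — there is a diffeomorphism `Φ` of `E` with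
  `sign F₁(Φ x) = sign F₀(x)` for all `x` (three clauses), fixing every point outside the compact
  set `K ⊇ {|F_τ| ≤ ε₀}` and every point at which `∂_τ F(τ, ·)` vanishes for all `τ ∈ [0, 1]`;
* `RegularFamily.exists_diffeomorph_image_eq` — hence `Φ {F₀ ≤ 0} = {F₁ ≤ 0}`,
  `Φ {F₀ = 0} = {F₁ = 0}`, `Φ {F₀ < 0} = {F₁ < 0}`.

This is the isotopy lemma for a hypersurface moving without critical points (the case
`F(τ, x) = f(x) - (a + τ(b - a))` is Milnor, *Morse theory* (1963), Thm. 3.1, "`Mᵃ` is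
diffeomorphic to `Mᵇ`", with the same proof); the flow is that of Hirsch, *Differential
Topology* (1976), Ch. 8 §1, Thms. 1.1–1.2 (a compactly supported time-dependent vector field
generates diffeomorphisms), in the tree's form `Literature.Analysis.ODE.tdFlowDiffeomorph`
(`Literature/Analysis/ODE/CompactSupportFlow.lean`).

## Proof

Reparametrise by Mathlib's `Real.smoothTransition` (`G(τ, x) = F(λ(τ), x)`, so that the
hypotheses hold for all `τ` and `∂_τ G = 0` off `(0, 1)`, §4).  With a plateau cutoff `χ`
(`= 1` on `[-ε/3, ε/3]`, `= 0` off `(-ε/2, ε/2)`, §1) and `ε, μ` from the uniform regularity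
`|G| ≤ ε ⇒ ‖∇G‖ ≥ μ` (§3, compactness), the field
`X = -χ(G) ∂_τG ∇G / ‖∇G‖²` is `C^∞` (the coefficient vanishes near the points where `∇G = 0`)
and supported in `[0, 1] × K`; along a flow line `γ` the scalar `g(τ) = G(τ, γ τ)` satisfies
`g' = ∂_τG (1 - χ(g))`, so (§2, a clopen argument on `{τ | g τ = g τ₀}`) `g` is frozen as soon
as `|g| < ε/3` and can never cross the levels `±ε/4`; hence `F₁(Φ x) = F₀(x)` if
`|F₀ x| ≤ ε/4`, `F₁(Φ x) ≥ ε/4` if `F₀ x ≥ ε/4`, `F₁(Φ x) ≤ -ε/4` if `F₀ x ≤ -ε/4`, for the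
time-one map `Φ`.

## References

* J. Milnor, *Morse theory*, Ann. of Math. Studies 51 (1963), Thm. 3.1. [Milnor1963]
* M. W. Hirsch, *Differential Topology*, GTM 33 (1976), Ch. 8 §1, Thms. 1.1–1.2. [HirschDT1976]
* J. Schultens, *Introduction to 3-Manifolds*, GSM 151 (2014), Lemma 3.2.3 and Thm. 3.2.5.
  [Schultens2014]
-/

open scoped RealInnerProductSpace Topology Manifold ContDiff
open Set Filter Metric Function

noncomputable section

namespace Literature.Topology.FourManifolds

namespace RegularFamily

variable {E : Type*} [NormedAddCommGroup E] [InnerProductSpace ℝ E]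

/-! ### §1 A plateau cutoff -/

/-- The plateau cutoff `χ_{a,b}(s) = λ((s + b)/(b - a)) λ((b - s)/(b - a))` (`λ` Mathlib's
`Real.smoothTransition`): smooth, `= 1` on `[-a, a]`, `= 0` off `(-b, b)`, values in `[0, 1]`
(`0 < a < b`).  Elementary properties. [folklore] -/
theorem plateauCutoff_props {a b : ℝ} (hab : a < b) :
    ContDiff ℝ ∞ (fun s : ℝ => Real.smoothTransition ((s + b) / (b - a)) *
        Real.smoothTransition ((b - s) / (b - a))) ∧
      (∀ s, |s| ≤ a → Real.smoothTransition ((s + b) / (b - a)) *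
        Real.smoothTransition ((b - s) / (b - a)) = 1) ∧
      (∀ s, b ≤ |s| → Real.smoothTransition ((s + b) / (b - a)) *
        Real.smoothTransition ((b - s) / (b - a)) = 0) := by
  have hba : 0 < b - a := by linarith
  refine ⟨?_, fun s hs => ?_, fun s hs => ?_⟩
  · exact (Real.smoothTransition.contDiff.comp ((contDiff_id.add contDiff_const).div_const _)).mul
      (Real.smoothTransition.contDiff.comp ((contDiff_const.sub contDiff_id).div_const _))
  · have h1 : 1 ≤ (s + b) / (b - a) := by
      rw [le_div_iff₀ hba]; have := neg_abs_le s; linarith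
    have h2 : 1 ≤ (b - s) / (b - a) := by
      rw [le_div_iff₀ hba]; have := le_abs_self s; linarith
    rw [Real.smoothTransition.one_of_one_le h1, Real.smoothTransition.one_of_one_le h2, mul_one]
  · rcases le_or_gt 0 s with h0 | h0
    · rw [abs_of_nonneg h0] at hs
      have h2 : (b - s) / (b - a) ≤ 0 := div_nonpos_of_nonpos_of_nonneg (by linarith) hba.le
      rw [Real.smoothTransition.zero_of_nonpos h2, mul_zero]
    · rw [abs_of_neg h0] at hs
      have h1 : (s + b) / (b - a) ≤ 0 := div_nonpos_of_nonpos_of_nonneg (by linarith) hba.le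
      rw [Real.smoothTransition.zero_of_nonpos h1, zero_mul]

/-! ### §2 The clopen argument along a flow line -/

/-- **A scalar which cannot leave the plateau.**  If `g' = a · (1 - χ ∘ g)` where `χ = 1` on
`[-e, e]`, and `|g τ₀| < e`, then `g` is constant: the set `{τ | g τ = g τ₀}` is closed and open
(near such `τ` the derivative vanishes). [folklore] -/
theorem eq_of_hasDerivAt_mul_one_sub {g a χ : ℝ → ℝ} {e : ℝ}
    (hg : ∀ τ, HasDerivAt g (a τ * (1 - χ (g τ))) τ) (hχ : ∀ s, |s| ≤ e → χ s = 1)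
    {τ₀ : ℝ} (h0 : |g τ₀| < e) : ∀ τ, g τ = g τ₀ := by
  have hgc : Continuous g := continuous_iff_continuousAt.2 fun τ => (hg τ).continuousAt
  set W : Set ℝ := {τ | g τ = g τ₀} with hW
  have hWc : IsClosed W := isClosed_eq hgc continuous_const
  have hWo : IsOpen W := by
    rw [isOpen_iff_mem_nhds]
    intro τ₁ hτ₁
    have hτ₁' : |g τ₁| < e := by rw [show g τ₁ = g τ₀ from hτ₁]; exact h0
    -- near `τ₁`, `|g| < e`, so `g' = 0`
    have hev : ∀ᶠ τ in 𝓝 τ₁, |g τ| < e :=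
      (continuous_abs.comp hgc).continuousAt.eventually_lt continuousAt_const hτ₁'
    obtain ⟨r, hr, hball⟩ := Metric.eventually_nhds_iff_ball.1 hev
    have hderiv : ∀ τ ∈ ball τ₁ r, HasDerivAt g 0 τ := by
      intro τ hτ
      have := hg τ
      rwa [hχ _ (hball τ hτ).le, sub_self, mul_zero] at this
    have hconst : ∀ τ ∈ ball τ₁ r, g τ = g τ₁ := by
      intro τ hτ
      exact (convex_ball τ₁ r).is_const_of_fderivWithin_eq_zero (𝕜 := ℝ)
        (fun σ hσ => (hderiv σ hσ).differentiableAt.differentiableWithinAt)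
        (fun σ hσ => by
          rw [fderivWithin_eq_fderiv (isOpen_ball.uniqueDiffWithinAt hσ)
            (hderiv σ hσ).differentiableAt, (hderiv σ hσ).hasFDerivAt.fderiv]
          simp) hτ (mem_ball_self hr)
    exact mem_of_superset (ball_mem_nhds τ₁ hr) fun τ hτ => (hconst τ hτ).trans hτ₁
  have hWuniv : W = univ := IsClopen.eq_univ ⟨hWc, hWo⟩ ⟨τ₀, rfl⟩
  intro τ
  have : τ ∈ W := by rw [hWuniv]; trivial
  exact this

/-- **Upper barrier**: under the same hypotheses, if `g τ₀ ≥ e/2` (with `e/2 < e`... precisely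
if `e' < e` and `g τ₀ ≥ e'`, `0 ≤ e'`) then `g τ ≥ e'` for all `τ` (at a first crossing of
the level `e'` the scalar would be frozen). [folklore] -/
theorem le_of_hasDerivAt_mul_one_sub {g a χ : ℝ → ℝ} {e e' : ℝ}
    (hg : ∀ τ, HasDerivAt g (a τ * (1 - χ (g τ))) τ) (hχ : ∀ s, |s| ≤ e → χ s = 1)
    (he' : 0 ≤ e') (hee' : e' < e) {τ₀ : ℝ} (h0 : e' ≤ g τ₀) : ∀ τ, e' ≤ g τ := by
  have hgc : Continuous g := continuous_iff_continuousAt.2 fun τ => (hg τ).continuousAt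
  intro τ
  by_contra hlt
  push Not at hlt
  -- intermediate value: a time with `g = e'`
  obtain ⟨τ₂, -, hτ₂⟩ : ∃ τ₂ ∈ uIcc τ τ₀, g τ₂ = e' :=
    intermediate_value_uIcc hgc.continuousOn
      ⟨inf_le_left.trans hlt.le, h0.trans le_sup_right⟩
  have hfrozen := eq_of_hasDerivAt_mul_one_sub hg hχ (τ₀ := τ₂)
    (by rw [hτ₂, abs_of_nonneg he']; exact hee')
  have := hfrozen τ
  rw [hτ₂] at this
  linarith

/-- **Lower barrier** (symmetric statement). [folklore] -/
theorem le_neg_of_hasDerivAt_mul_one_sub {g a χ : ℝ → ℝ} {e e' : ℝ}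
    (hg : ∀ τ, HasDerivAt g (a τ * (1 - χ (g τ))) τ) (hχ : ∀ s, |s| ≤ e → χ s = 1)
    (he' : 0 ≤ e') (hee' : e' < e) {τ₀ : ℝ} (h0 : g τ₀ ≤ -e') : ∀ τ, g τ ≤ -e' := by
  have hgc : Continuous g := continuous_iff_continuousAt.2 fun τ => (hg τ).continuousAt
  intro τ
  by_contra hlt
  push Not at hlt
  obtain ⟨τ₂, -, hτ₂⟩ : ∃ τ₂ ∈ uIcc τ₀ τ, g τ₂ = -e' :=
    intermediate_value_uIcc hgc.continuousOn
      ⟨inf_le_left.trans h0, hlt.le.trans le_sup_right⟩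
  have hfrozen := eq_of_hasDerivAt_mul_one_sub hg hχ (τ₀ := τ₂)
    (by rw [hτ₂, abs_neg, abs_of_nonneg he']; exact hee')
  have := hfrozen τ
  rw [hτ₂] at this
  linarith

/-! ### §3 Uniform regularity near the zero sets -/

section Uniform

/-- **Uniform lower bound for the spatial derivative near the zero sets of a compact family.**
If for every `τ ∈ [0, 1]` the function `F_τ = F(τ, ·)` has nonvanishing derivative on its zero
set and `{|F_τ| ≤ ε₀} ⊆ K` for a compact `K`, then `‖DF_τ(x)‖ ≥ μ > 0` whenever `τ ∈ [0, 1]`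
and `|F_τ(x)| ≤ ε`, for some `μ, ε > 0`. [folklore] -/
theorem exists_forall_norm_fderiv_ge {F : ℝ × E → ℝ} (hF : ContDiff ℝ 1 F) {K : Set E}
    (hK : IsCompact K) {ε₀ : ℝ} (hε₀ : 0 < ε₀)
    (hKF : ∀ τ ∈ Icc (0 : ℝ) 1, ∀ x, |F (τ, x)| ≤ ε₀ → x ∈ K)
    (hreg : ∀ τ ∈ Icc (0 : ℝ) 1, ∀ x, F (τ, x) = 0 → fderiv ℝ (fun y => F (τ, y)) x ≠ 0) :
    ∃ μ, 0 < μ ∧ ∃ ε, 0 < ε ∧ ε ≤ ε₀ ∧ ∀ τ ∈ Icc (0 : ℝ) 1, ∀ x, |F (τ, x)| ≤ ε →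
      μ ≤ ‖fderiv ℝ (fun y => F (τ, y)) x‖ := by
  have hFc : Continuous F := hF.continuous
  -- the spatial derivative as a continuous function of `(τ, x)`
  have hD : ∀ p : ℝ × E, fderiv ℝ (fun y => F (p.1, y)) p.2 =
      (fderiv ℝ F p).comp (ContinuousLinearMap.inr ℝ ℝ E) := by
    intro p
    have h := (hF.differentiable one_ne_zero (p.1, p.2)).hasFDerivAt.comp p.2
      (hasFDerivAt_prodMk_right (𝕜 := ℝ) p.1 p.2)
    exact h.fderiv
  have hDc : Continuous fun p : ℝ × E => fderiv ℝ (fun y => F (p.1, y)) p.2 := by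
    have : (fun p : ℝ × E => fderiv ℝ (fun y => F (p.1, y)) p.2) =
        fun p => (fderiv ℝ F p).comp (ContinuousLinearMap.inr ℝ ℝ E) := funext hD
    rw [this]
    exact ((ContinuousLinearMap.compL ℝ E (ℝ × E) ℝ).flip
      (ContinuousLinearMap.inr ℝ ℝ E)).continuous.comp (hF.continuous_fderiv one_ne_zero)
  set S : Set (ℝ × E) := Icc (0 : ℝ) 1 ×ˢ K with hS
  have hSc : IsCompact S := isCompact_Icc.prod hK
  set Z : Set (ℝ × E) := S ∩ F ⁻¹' {0} with hZ
  have hZc : IsCompact Z := hSc.inter_right (isClosed_singleton.preimage hFc)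
  obtain ⟨μ, hμ, hμZ⟩ : ∃ μ, 0 < μ ∧ ∀ p ∈ Z, 2 * μ ≤ ‖fderiv ℝ (fun y => F (p.1, y)) p.2‖ := by
    by_cases hne : Z.Nonempty
    · obtain ⟨p₀, hp₀, hmin⟩ := hZc.exists_isMinOn hne (continuous_norm.comp hDc).continuousOn
      have hpos : 0 < ‖fderiv ℝ (fun y => F (p₀.1, y)) p₀.2‖ :=
        norm_pos_iff.2 (hreg p₀.1 hp₀.1.1 p₀.2 hp₀.2)
      exact ⟨‖fderiv ℝ (fun y => F (p₀.1, y)) p₀.2‖ / 2, by positivity, fun p hp => by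
        have h' : ‖fderiv ℝ (fun y => F (p₀.1, y)) p₀.2‖ ≤ ‖fderiv ℝ (fun y => F (p.1, y)) p.2‖ :=
          hmin hp
        linarith⟩
    · exact ⟨1, one_pos, fun p hp => (hne ⟨p, hp⟩).elim⟩
  obtain ⟨ε, hε, hsub⟩ := ExpHeight.exists_pos_inter_subset hSc
    (isOpen_lt continuous_const (continuous_norm.comp hDc)) (P := fun ε => {p | |F p| ≤ ε})
    (fun ε _ => isClosed_le (continuous_abs.comp hFc) continuous_const)
    (fun ε ε' _ h p hp => le_trans (show |F p| ≤ ε from hp) h)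
    (fun p hpS hall => by
      have hp0 : F p = 0 := by
        by_contra h0
        have hpos : 0 < |F p| := abs_pos.2 h0
        have h' : |F p| ≤ |F p| / 2 := hall (|F p| / 2) (by positivity)
        linarith
      have := hμZ p ⟨hpS, hp0⟩
      show μ < ‖fderiv ℝ (fun y => F (p.1, y)) p.2‖
      linarith)
  refine ⟨μ, hμ, min ε ε₀, lt_min hε hε₀, min_le_right _ _, fun τ hτ x hx => ?_⟩
  have hxK : x ∈ K := hKF τ hτ x (hx.trans (min_le_right _ _))
  exact le_of_lt (hsub ⟨⟨hτ, hxK⟩, hx.trans (min_le_left _ _)⟩)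

end Uniform

/-! ### §4 The time derivative of `smoothTransition` vanishes off `(0, 1)` -/

/-- `smoothTransition' τ = 0` for `τ ≤ 0` and for `1 ≤ τ` (it is constant on `(-∞, 0]` and on
`[1, ∞)`; at the junction points it has a local extremum). [folklore] -/
theorem deriv_smoothTransition_eq_zero {τ : ℝ} (hτ : τ ≤ 0 ∨ 1 ≤ τ) :
    deriv Real.smoothTransition τ = 0 := by
  rcases hτ with hτ | hτ
  · apply IsLocalMin.deriv_eq_zero
    filter_upwards with x
    rw [Real.smoothTransition.zero_of_nonpos hτ]
    exact Real.smoothTransition.nonneg x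
  · apply IsLocalMax.deriv_eq_zero
    filter_upwards with x
    rw [Real.smoothTransition.one_of_one_le hτ]
    exact Real.smoothTransition.le_one x

/-! ### §5 The main theorem -/

section Main

variable [FiniteDimensional ℝ E]

/-- **A regular family of compact domains is an ambient isotopy class.**  Let
`F : ℝ × E → ℝ` be `C^∞` on a finite-dimensional real inner product space, and suppose that for
every `τ ∈ [0, 1]` the zero set of `F_τ = F(τ, ·)` consists of regular points (`DF_τ ≠ 0`) and
the band `{|F_τ| ≤ ε₀}` lies in a fixed compact set `K`.  Then there is a diffeomorphism `Φ` of
`E` (the time-`1` map of the compactly supported time-dependent field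
`X = -χ(F_τ) ∂_τF_τ ∇F_τ / ‖∇F_τ‖²`, along which `F_τ` is frozen near the zero sets) with
`sign F_1(Φ x) = sign F_0(x)` for every `x` — so `Φ {F_0 ≤ 0} = {F_1 ≤ 0}` and
`Φ {F_0 = 0} = {F_1 = 0}` — which fixes every point outside `K` and every point at which
`∂_τ F` vanishes for all `τ ∈ [0, 1]`.  (The isotopy lemma for hypersurfaces moving without
critical points; Milnor, *Morse theory* (1963), proof of Thm. 3.1, is the case
`F(τ, x) = f(x) - (a + τ(b - a))`; Hirsch (1976), Ch. 8 §1, Thms. 1.1–1.2 for the flow.)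
[folklore] -/
theorem exists_diffeomorph_sign_eq {F : ℝ × E → ℝ} (hF : ContDiff ℝ ∞ F) {K : Set E}
    (hK : IsCompact K) {ε₀ : ℝ} (hε₀ : 0 < ε₀)
    (hKF : ∀ τ ∈ Icc (0 : ℝ) 1, ∀ x, |F (τ, x)| ≤ ε₀ → x ∈ K)
    (hreg : ∀ τ ∈ Icc (0 : ℝ) 1, ∀ x, F (τ, x) = 0 → fderiv ℝ (fun y => F (τ, y)) x ≠ 0) :
    ∃ Φ : E ≃ₘ⟮𝓘(ℝ, E), 𝓘(ℝ, E)⟯ E,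
      (∀ x, F (1, Φ x) < 0 ↔ F (0, x) < 0) ∧ (∀ x, F (1, Φ x) = 0 ↔ F (0, x) = 0) ∧
      (∀ x, 0 < F (1, Φ x) ↔ 0 < F (0, x)) ∧
      (∀ x, (∀ τ ∈ Icc (0 : ℝ) 1, fderiv ℝ F (τ, x) (1, 0) = 0) → Φ x = x) ∧
      (∀ x, x ∉ K → Φ x = x) := by
  haveI : CompleteSpace E := FiniteDimensional.complete ℝ E
  -- uniform constants
  obtain ⟨μ, hμ, ε, hε, hεε₀, hbound⟩ :=
    exists_forall_norm_fderiv_ge (hF.of_le (by norm_cast)) hK hε₀ hKF hreg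
  -- the cutoff
  have hab : ε / 3 < ε / 2 := by linarith
  obtain ⟨hχs, hχ1, hχ0⟩ := plateauCutoff_props hab
  set χ : ℝ → ℝ := fun s => Real.smoothTransition ((s + ε / 2) / (ε / 2 - ε / 3)) *
    Real.smoothTransition ((ε / 2 - s) / (ε / 2 - ε / 3)) with hχdef
  -- the reparametrised family
  set ST := Real.smoothTransition with hST
  have hST01 : ∀ τ, ST τ ∈ Icc (0 : ℝ) 1 :=
    fun τ => ⟨Real.smoothTransition.nonneg τ, Real.smoothTransition.le_one τ⟩
  set G : ℝ × E → ℝ := fun p => F (ST p.1, p.2) with hGdef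
  have hGs : ContDiff ℝ ∞ G :=
    hF.comp ((Real.smoothTransition.contDiff.comp contDiff_fst).prodMk contDiff_snd)
  have hGd : Differentiable ℝ G := hGs.differentiable (by simp)
  -- spatial derivative and gradient
  set A : ℝ × E → (E →L[ℝ] ℝ) := fun p => (fderiv ℝ G p).comp (ContinuousLinearMap.inr ℝ ℝ E)
    with hAdef
  have hA : ∀ p : ℝ × E, fderiv ℝ (fun y => G (p.1, y)) p.2 = A p := by
    intro p
    have h := (hGd (p.1, p.2)).hasFDerivAt.comp p.2 (hasFDerivAt_prodMk_right (𝕜 := ℝ) p.1 p.2)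
    exact h.fderiv
  have hAs : ContDiff ℝ ∞ A :=
    ((ContinuousLinearMap.compL ℝ E (ℝ × E) ℝ).flip (ContinuousLinearMap.inr ℝ ℝ E)).contDiff.comp
      (hGs.fderiv_right (m := ∞) le_rfl)
  set w : ℝ × E → E := fun p => (InnerProductSpace.toDual ℝ E).symm (A p) with hwdef
  have hws : ContDiff ℝ ∞ w :=
    (InnerProductSpace.toDual ℝ E).symm.toContinuousLinearEquiv.contDiff.comp hAs
  have hw_inner : ∀ p v, ⟪w p, v⟫ = A p v := fun p v => InnerProductSpace.toDual_symm_apply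
  have hw_norm : ∀ p, ‖w p‖ = ‖A p‖ := fun p => (InnerProductSpace.toDual ℝ E).symm.norm_map _
  -- time derivative
  set b : ℝ × E → ℝ := fun p => fderiv ℝ G p (1, 0) with hbdef
  have hbs : ContDiff ℝ ∞ b :=
    (ContinuousLinearMap.apply ℝ ℝ ((1 : ℝ), (0 : E))).contDiff.comp (hGs.fderiv_right (m := ∞) le_rfl)
  -- the bound for `G`: `|G p| ≤ ε → μ ≤ ‖A p‖`
  have hboundG : ∀ p : ℝ × E, |G p| ≤ ε → μ ≤ ‖A p‖ := by
    intro p hp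
    rw [← hA p]
    exact hbound (ST p.1) (hST01 p.1) p.2 hp
  -- the scalar coefficient and the field
  set c : ℝ × E → ℝ := fun p => -(χ (G p) * b p / ‖w p‖ ^ 2) with hcdef
  set X : ℝ × E → E := fun p => c p • w p with hXdef
  -- `χ ∘ G` vanishes near points where `A = 0`
  have hχG0 : ∀ p : ℝ × E, A p = 0 → ∀ᶠ q in 𝓝 p, χ (G q) = 0 := by
    intro p hp
    have hGp : ε < |G p| := by
      by_contra hle
      push Not at hle
      have := hboundG p hle
      rw [hp, norm_zero] at this
      linarith
    have h1 : ε / 2 < |G p| := by linarith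
    have hev : ∀ᶠ q in 𝓝 p, ε / 2 < |G q| :=
      (continuous_abs.comp hGs.continuous).continuousAt.eventually_const_lt h1
    exact hev.mono fun q hq => hχ0 _ hq.le
  -- smoothness of the coefficient and of the field
  have hnorm2 : ContDiff ℝ ∞ fun p : ℝ × E => ‖w p‖ ^ 2 := (contDiff_norm_sq ℝ).comp hws
  have hcs : ContDiff ℝ ∞ c := by
    rw [contDiff_iff_contDiffAt]
    intro p
    by_cases hp : A p = 0
    · have hev : c =ᶠ[𝓝 p] fun _ => 0 := (hχG0 p hp).mono fun q hq => by
        simp only [hcdef, hq, zero_mul, zero_div, neg_zero]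
      exact (contDiffAt_const.congr_of_eventuallyEq hev)
    · have hwp : ‖w p‖ ^ 2 ≠ 0 := by
        rw [hw_norm p]; exact pow_ne_zero 2 (norm_ne_zero_iff.2 hp)
      have h1 : ContDiffAt ℝ ∞ (fun q => (‖w q‖ ^ 2)⁻¹) p := (hnorm2.contDiffAt).inv hwp
      have h2 : ContDiffAt ℝ ∞ (fun q => χ (G q) * b q * (‖w q‖ ^ 2)⁻¹) p :=
        (((hχs.comp hGs).contDiffAt).mul hbs.contDiffAt).mul h1
      refine (h2.neg).congr_of_eventuallyEq (Eventually.of_forall fun q => ?_)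
      simp only [hcdef, div_eq_mul_inv]
  have hXs : ContDiff ℝ ∞ X := hcs.smul hws
  -- the time derivative in terms of `F`
  have hb_formula : ∀ p : ℝ × E, b p = deriv ST p.1 * fderiv ℝ F (ST p.1, p.2) (1, 0) := by
    rintro ⟨τ, x⟩
    have hFd : DifferentiableAt ℝ F (ST τ, x) := hF.differentiable (by simp) _
    -- derivative of `τ ↦ G (τ, x)` computed in two ways
    have hc1 : HasDerivAt (fun σ : ℝ => ((σ, x) : ℝ × E)) ((1 : ℝ), (0 : E)) τ :=
      (hasDerivAt_id τ).prodMk (hasDerivAt_const τ x)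
    have h1 : HasDerivAt (G ∘ fun σ : ℝ => ((σ, x) : ℝ × E)) (fderiv ℝ G (τ, x) ((1 : ℝ), (0 : E))) τ :=
      (hGd (τ, x)).hasFDerivAt.comp_hasDerivAt τ hc1
    have hSTd : HasDerivAt ST (deriv ST τ) τ :=
      (Real.smoothTransition.contDiff (n := 1)).differentiable one_ne_zero _ |>.hasDerivAt
    have hc2 : HasDerivAt (fun σ : ℝ => ((ST σ, x) : ℝ × E)) ((deriv ST τ, (0 : E)) : ℝ × E) τ :=
      hSTd.prodMk (hasDerivAt_const τ x)
    have h2 : HasDerivAt (F ∘ fun σ : ℝ => ((ST σ, x) : ℝ × E))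
        (fderiv ℝ F (ST τ, x) ((deriv ST τ, (0 : E)) : ℝ × E)) τ :=
      hFd.hasFDerivAt.comp_hasDerivAt τ hc2
    have h12 : (G ∘ fun σ : ℝ => ((σ, x) : ℝ × E)) = (F ∘ fun σ : ℝ => ((ST σ, x) : ℝ × E)) := by
      funext σ; rfl
    rw [h12] at h1
    have heq := h1.unique h2
    show fderiv ℝ G (τ, x) ((1 : ℝ), (0 : E)) = deriv ST τ * fderiv ℝ F (ST τ, x) (1, 0)
    rw [heq, show ((deriv ST τ, (0 : E)) : ℝ × E) = deriv ST τ • ((1 : ℝ), (0 : E)) by simp,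
      map_smul, smul_eq_mul]
  -- the field vanishes where `b = 0` or `χ ∘ G = 0`
  have hX0_of_b : ∀ p, b p = 0 → X p = 0 := fun p hp => by
    simp only [hXdef, hcdef, hp, mul_zero, zero_div, neg_zero, zero_smul]
  have hX0_of_χ : ∀ p, χ (G p) = 0 → X p = 0 := fun p hp => by
    simp only [hXdef, hcdef, hp, zero_mul, zero_div, neg_zero, zero_smul]
  have hχG0_of_notMem : ∀ p : ℝ × E, p.2 ∉ K → χ (G p) = 0 := by
    intro p hp
    apply hχ0
    by_contra hlt
    push Not at hlt
    exact hp (hKF (ST p.1) (hST01 p.1) p.2 (by linarith [hεε₀] : |F (ST p.1, p.2)| ≤ ε₀))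
  -- compact support
  have hXsupp : HasCompactSupport X := by
    refine HasCompactSupport.intro (isCompact_Icc.prod hK : IsCompact (Icc (0 : ℝ) 1 ×ˢ K))
      fun p hp => ?_
    rw [mem_prod, not_and_or] at hp
    rcases hp with hp | hp
    · apply hX0_of_b
      rw [hb_formula]
      have : deriv ST p.1 = 0 := by
        apply deriv_smoothTransition_eq_zero
        rcases not_and_or.1 (show ¬(0 ≤ p.1 ∧ p.1 ≤ 1) from hp) with h | h
        · exact Or.inl (not_le.1 h).le
        · exact Or.inr (not_le.1 h).le
      rw [this, zero_mul]
    · exact hX0_of_χ p (hχG0_of_notMem p hp)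
  -- the flow
  have hn : (1 : ℕ∞) ≤ ⊤ := le_top
  set Φ := Literature.Analysis.ODE.tdFlowDiffeomorph hXs hXsupp hn 0 1 with hΦdef
  -- flow lines: `g(τ) = G(τ, γ τ)` satisfies `g' = b (1 - χ ∘ g)`
  have hline : ∀ x : E, ∀ τ, HasDerivAt (fun τ => G (τ, Literature.Analysis.ODE.tdFlow hXs hXsupp hn 0 τ x))
      (b (τ, Literature.Analysis.ODE.tdFlow hXs hXsupp hn 0 τ x) *
        (1 - χ (G (τ, Literature.Analysis.ODE.tdFlow hXs hXsupp hn 0 τ x)))) τ := by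
    intro x τ
    set γ : ℝ → E := fun τ => Literature.Analysis.ODE.tdFlow hXs hXsupp hn 0 τ x with hγ
    have hγd : HasDerivAt γ (X (τ, γ τ)) τ := Literature.Analysis.ODE.hasDerivAt_tdFlow hXs hXsupp hn 0 x τ
    have hcurve : HasDerivAt (fun τ : ℝ => ((τ, γ τ) : ℝ × E)) ((1 : ℝ), X (τ, γ τ)) τ :=
      (hasDerivAt_id τ).prodMk hγd
    have h := (hGd (τ, γ τ)).hasFDerivAt.comp_hasDerivAt τ hcurve
    have hval : fderiv ℝ G (τ, γ τ) ((1 : ℝ), X (τ, γ τ)) =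
        b (τ, γ τ) * (1 - χ (G (τ, γ τ))) := by
      set p : ℝ × E := (τ, γ τ) with hpdef
      have hsplit : ((1 : ℝ), X p) = ((1 : ℝ), (0 : E)) + ((0 : ℝ), X p) := by simp
      rw [hsplit, map_add]
      have hAp : fderiv ℝ G p ((0 : ℝ), X p) = A p (X p) := by
        simp only [hAdef, ContinuousLinearMap.comp_apply, ContinuousLinearMap.inr_apply]
      rw [hAp, ← hw_inner]
      by_cases hp0 : A p = 0
      · have hχ0' : χ (G p) = 0 := (hχG0 p hp0).self_of_nhds
        rw [hX0_of_χ p hχ0', inner_zero_right, hχ0']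
        simp [hbdef]
      · have hwp : ‖w p‖ ^ 2 ≠ 0 := by
          rw [hw_norm p]; exact pow_ne_zero 2 (norm_ne_zero_iff.2 hp0)
        have hw0 : ‖w p‖ ≠ 0 := by rw [hw_norm p]; exact norm_ne_zero_iff.2 hp0
        simp only [hXdef, hcdef, inner_smul_right, real_inner_self_eq_norm_sq]
        rw [show fderiv ℝ G p ((1 : ℝ), (0 : E)) = b p from rfl]
        field_simp
        ring
    rw [hval] at h
    exact h
  -- consequences along flow lines
  have hΦ1 : ∀ x, Φ x = Literature.Analysis.ODE.tdFlow hXs hXsupp hn 0 1 x := fun x => rfl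
  have hG0 : ∀ x, G (0, Literature.Analysis.ODE.tdFlow hXs hXsupp hn 0 0 x) = F (0, x) := by
    intro x
    rw [Literature.Analysis.ODE.tdFlow_self]
    simp [hGdef, hST, Real.smoothTransition.zero]
  have hG1 : ∀ x, G (1, Literature.Analysis.ODE.tdFlow hXs hXsupp hn 0 1 x) = F (1, Φ x) := by
    intro x
    simp [hGdef, hST, Real.smoothTransition.one, hΦ1]
  have hχ1' : ∀ s, |s| ≤ ε / 3 → χ s = 1 := hχ1
  have hfrozen : ∀ x, |F (0, x)| ≤ ε / 4 → F (1, Φ x) = F (0, x) := by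
    intro x hx
    have := eq_of_hasDerivAt_mul_one_sub (hline x) hχ1' (τ₀ := 0)
      (by rw [hG0]; linarith [hx])
    rw [← hG1, ← hG0, this 1]
  have hupper : ∀ x, ε / 4 ≤ F (0, x) → ε / 4 ≤ F (1, Φ x) := by
    intro x hx
    have := le_of_hasDerivAt_mul_one_sub (hline x) hχ1' (e' := ε / 4) (by positivity)
      (by linarith) (τ₀ := 0) (by rw [hG0]; exact hx)
    rw [← hG1]; exact this 1
  have hlower : ∀ x, F (0, x) ≤ -(ε / 4) → F (1, Φ x) ≤ -(ε / 4) := by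
    intro x hx
    have := le_neg_of_hasDerivAt_mul_one_sub (hline x) hχ1' (e' := ε / 4) (by positivity)
      (by linarith) (τ₀ := 0) (by rw [hG0]; exact hx)
    rw [← hG1]; exact this 1
  have hneg : ∀ x, F (0, x) < 0 → F (1, Φ x) < 0 := by
    intro x hx
    rcases le_or_gt (F (0, x)) (-(ε / 4)) with h | h
    · linarith [hlower x h]
    · rw [hfrozen x (by rw [abs_of_neg hx]; linarith)]; exact hx
  have hzero : ∀ x, F (0, x) = 0 → F (1, Φ x) = 0 := by
    intro x hx
    rw [hfrozen x (by rw [hx, abs_zero]; positivity), hx]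
  have hpos : ∀ x, 0 < F (0, x) → 0 < F (1, Φ x) := by
    intro x hx
    rcases le_or_gt (ε / 4) (F (0, x)) with h | h
    · linarith [hupper x h]
    · rw [hfrozen x (by rw [abs_of_pos hx]; linarith)]; exact hx
  refine ⟨Φ, fun x => ⟨fun h => ?_, hneg x⟩, fun x => ⟨fun h => ?_, hzero x⟩,
    fun x => ⟨fun h => ?_, hpos x⟩, fun x hx => ?_, fun x hx => ?_⟩
  · rcases lt_trichotomy (F (0, x)) 0 with h' | h' | h'
    · exact h'
    · linarith [hzero x h']
    · linarith [hpos x h']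
  · rcases lt_trichotomy (F (0, x)) 0 with h' | h' | h'
    · linarith [hneg x h']
    · exact h'
    · linarith [hpos x h']
  · rcases lt_trichotomy (F (0, x)) 0 with h' | h' | h'
    · linarith [hneg x h']
    · linarith [hzero x h']
    · exact h'
  · -- stationary points are fixed
    rw [hΦ1]
    refine Literature.Analysis.ODE.tdFlow_eq_self_of_forall_eq_zero hXs hXsupp hn (fun τ => ?_) 0 1
    apply hX0_of_b
    rw [hb_formula]
    rw [hx (ST τ) (hST01 τ), mul_zero]
  · -- points outside `K` are fixed
    rw [hΦ1]
    exact Literature.Analysis.ODE.tdFlow_eq_self_of_forall_eq_zero hXs hXsupp hn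
      (fun τ => hX0_of_χ _ (hχG0_of_notMem (τ, x) hx)) 0 1

/-- **Image form.** Under the hypotheses of `exists_diffeomorph_sign_eq`, the diffeomorphism
carries the domain `{F_0 ≤ 0}` onto `{F_1 ≤ 0}`, the hypersurface `{F_0 = 0}` onto `{F_1 = 0}`
and the open sides onto each other. [folklore] -/
theorem exists_diffeomorph_image_eq {F : ℝ × E → ℝ} (hF : ContDiff ℝ ∞ F) {K : Set E}
    (hK : IsCompact K) {ε₀ : ℝ} (hε₀ : 0 < ε₀)
    (hKF : ∀ τ ∈ Icc (0 : ℝ) 1, ∀ x, |F (τ, x)| ≤ ε₀ → x ∈ K)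
    (hreg : ∀ τ ∈ Icc (0 : ℝ) 1, ∀ x, F (τ, x) = 0 → fderiv ℝ (fun y => F (τ, y)) x ≠ 0) :
    ∃ Φ : E ≃ₘ⟮𝓘(ℝ, E), 𝓘(ℝ, E)⟯ E,
      Φ '' {x | F (0, x) ≤ 0} = {x | F (1, x) ≤ 0} ∧ Φ '' {x | F (0, x) = 0} = {x | F (1, x) = 0} ∧
      Φ '' {x | F (0, x) < 0} = {x | F (1, x) < 0} ∧
      (∀ x, (∀ τ ∈ Icc (0 : ℝ) 1, fderiv ℝ F (τ, x) (1, 0) = 0) → Φ x = x) ∧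
      (∀ x, x ∉ K → Φ x = x) := by
  obtain ⟨Φ, hneg, hzero, hpos, hfix, hK'⟩ := exists_diffeomorph_sign_eq hF hK hε₀ hKF hreg
  have key : ∀ (P : ℝ → Prop), (∀ x, P (F (1, Φ x)) ↔ P (F (0, x))) →
      Φ '' {x | P (F (0, x))} = {x | P (F (1, x))} := by
    intro P hP
    ext y
    simp only [mem_image, mem_setOf_eq]
    constructor
    · rintro ⟨x, hx, rfl⟩
      exact (hP x).2 hx
    · intro hy
      refine ⟨Φ.symm y, (hP _).1 ?_, Φ.apply_symm_apply y⟩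
      rw [Φ.apply_symm_apply]; exact hy
  refine ⟨Φ, key (· ≤ 0) fun x => ?_, key (· = 0) hzero, key (· < 0) hneg, hfix, hK'⟩
  simp only [le_iff_lt_or_eq]
  exact or_congr (hneg x) (hzero x)

end Main

end RegularFamily

end Literature.Topology.FourManifolds

end
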